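import Summits.CriticalPhenomena.PercolationContinuityZ3.Theorems.PercNearOneGluingNoHeavyRsw3ClusterMomentSums
import HarnessLib

/-!
# RSW3 lane (P2, gen 22): BCKS CLUSTER MOMENTS, IV — NO MULTISCALING: EVERY SIZE-BIASED CLUSTER SUM
# `Σ_C |C ∩ Λ_N|^{m}` (`m ≥ 2`) HAS ALL ITS MOMENTS ON THE SINGLE SCALE `s(N)^m = (|Λ_N|π_{p_c}(N))^m` UNDER (A2)□

builds on p205010 (kernel theorem, internal audit signed; external expert review pending) — NOT used in this file.

Cell `prim-rsw3`, prover seat `prim-rsw3-p2` (gen 22), memo `run/shared/lean/prim/rsw3/P2-RSWLITE.md` §29.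
Support file (`--supports stmt-CriticalPhenomena-4575`); no definitions, no named facts, no sorries.

`V_x = #{w ∈ Λ(N) : x ↔ w}`, `S_m := Σ_{x ∈ Λ(N)} V_x^{m−1} = Σ_C |C ∩ Λ(N)|^m` (`m = j+2 ≥ 2`; `S_2 = T_N` of part II), `M_N = max_x V_x`,
`s(N) = (2N+1)^d π(N)`.  Pointwise `M_N^m ≤ S_m ≤ M_N^{m−2} T_N` and `M_N² ≤ T_N`, so `S_m² ≤ T_N^m`: every size-biased sum is squeezed
between powers of the largest cluster and of the pair count, whose moments are all of order `s(N)^{·}` (part II, gen 21).  Hence: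

* §1 `sum_pow_succ_le_sup_pow_mul_pairCount` (`S_{j+2} ≤ M^j T`), `sq_sum_pow_succ_le_pairCount_pow` (`S_{j+2}² ≤ T^{j+2}`);
* §2 (every `p > 0`, (R1), (R_lin), (R2), `π(1) > 0`) **`exists_integral_sum_pow_pow_le`**: `E_p S_{j+2}^{t+1} ≤ C s_p(N)^{(j+2)(t+1)}`
  (`f ≤ (S + f²/S)/2` with `S = s^{(j+2)(t+1)}` and part II at the exponent `(j+2)(t+1)`);
* §3 (`p_c(ℤ^d)`, (A2)□ at one aspect) **`exists_integral_sum_pow_pow_two_sided_of_setToSetQuasiMultAspectAt`**: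
  `c s(N)^{(j+2)(t+1)} ≤ E_{p_c} (Σ_C |C ∩ Λ_N|^{j+2})^{t+1} ≤ C s(N)^{(j+2)(t+1)}` for `N ≥ N₀` — for every `m ≥ 2` and every `t`, the
  `t`-th moment of `Σ_C |C ∩ Λ_N|^m` is `≍ (E|C_max|)^{mt}`: a single exponent governs the whole cluster-size distribution of the
  box at the macroscopic end (BCKS 2001 'no multiscaling' reading of Thm. 1.1; here from (A2)□ in every `d`); §4 `ℤ²` unconditional.

References: C. Borgs, J. T. Chayes, H. Kesten, J. Spencer, Comm. Math. Phys. 224 (2001) 153–204, Thm. 1.1 [BorgsChayesKestenSpencer2001];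
Random Structures Algorithms 15 (1999) 368–413 [BorgsChayesKestenSpencer1999]; H. Kesten, PTRF 73 (1986), Thm. (8) [Kesten1986];
D. Basu, A. Sapozhnikov, ECP 22 (2017) §1 (A2) [BasuSapozhnikov2017ECP]. [folklore]
-/

noncomputable section

namespace Summit.CriticalPhenomena.PercolationContinuityZ3.Theorems

namespace Rsw3

open MeasureTheory Literature.Probability.LatticeModels Literature.Probability.Percolation
open SurfaceTension Crossing SimpleGraph Finset

variable {d : ℕ}

/-! ## §1 Pointwise squeeze of the size-biased sums -/

open Classical in
/-- **`Σ_x V_x^{j+2-1} ≤ M_N^j · T_N`**: `V_x^{j+1} = V_x^j · V_x ≤ M_N^j · V_x` and `T_N = Σ_x V_x`. [folklore] -/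
theorem sum_pow_succ_le_sup_pow_mul_pairCount (N j : ℕ) (ω : BondConfig (Site d)) :
    ∑ x ∈ box d N, ((((box d N).filter fun w => ω ∈ (openConn x w : Set (BondConfig (Site d)))).card : ℕ) : ℝ) ^ (j + 1) ≤
      (((box d N).sup fun y => ((box d N).filter fun w => ω ∈ (openConn y w : Set (BondConfig (Site d)))).card : ℕ) : ℝ) ^ j *
        (((box d N ×ˢ box d N).filter fun xw => ω ∈ (openConn xw.1 xw.2 : Set (BondConfig (Site d)))).card : ℝ) := by
  classical
  rw [card_filter_pairs_eq_sum, Finset.mul_sum]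
  refine Finset.sum_le_sum fun x hx => ?_
  rw [pow_succ]
  refine mul_le_mul_of_nonneg_right (pow_le_pow_left₀ (Nat.cast_nonneg _) ?_ j) (Nat.cast_nonneg _)
  exact_mod_cast Finset.le_sup (f := fun y => ((box d N).filter fun w =>
    ω ∈ (openConn y w : Set (BondConfig (Site d)))).card) hx

open Classical in
/-- **`(Σ_x V_x^{j+1})² ≤ T_N^{j+2}`** (`S ≤ M^j T` and `M² ≤ T`). [folklore] -/
theorem sq_sum_pow_succ_le_pairCount_pow (N j : ℕ) (ω : BondConfig (Site d)) :
    (∑ x ∈ box d N, ((((box d N).filter fun w => ω ∈ (openConn x w : Set (BondConfig (Site d)))).card : ℕ) : ℝ) ^ (j + 1)) ^ 2 ≤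
      (((box d N ×ˢ box d N).filter fun xw => ω ∈ (openConn xw.1 xw.2 : Set (BondConfig (Site d)))).card : ℝ) ^ (j + 2) := by
  classical
  set M : ℝ := (((box d N).sup fun y => ((box d N).filter fun w =>
    ω ∈ (openConn y w : Set (BondConfig (Site d)))).card : ℕ) : ℝ) with hM
  set T : ℝ := (((box d N ×ˢ box d N).filter fun xw => ω ∈ (openConn xw.1 xw.2 : Set (BondConfig (Site d)))).card : ℝ) with hT
  have hM0 : 0 ≤ M := Nat.cast_nonneg _
  have hT0 : 0 ≤ T := Nat.cast_nonneg _
  have hS0 : 0 ≤ ∑ x ∈ box d N, ((((box d N).filter fun w =>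
      ω ∈ (openConn x w : Set (BondConfig (Site d)))).card : ℕ) : ℝ) ^ (j + 1) :=
    Finset.sum_nonneg fun x _ => pow_nonneg (Nat.cast_nonneg _) _
  have h1 := sum_pow_succ_le_sup_pow_mul_pairCount N j ω
  have h2 : M ^ 2 ≤ T := sq_sup_le_pairCount N ω
  calc (∑ x ∈ box d N, ((((box d N).filter fun w => ω ∈ (openConn x w : Set (BondConfig (Site d)))).card : ℕ) : ℝ) ^ (j + 1)) ^ 2
      ≤ (M ^ j * T) ^ 2 := pow_le_pow_left₀ hS0 h1 2
    _ = (M ^ 2) ^ j * T ^ 2 := by ring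
    _ ≤ T ^ j * T ^ 2 := mul_le_mul_of_nonneg_right (pow_le_pow_left₀ (pow_nonneg hM0 2) h2 j) (pow_nonneg hT0 2)
    _ = T ^ (j + 2) := by ring

/-! ## §2 Every `p`: all moments of every size-biased sum -/

open Classical in
/-- The size-biased sum `ω ↦ Σ_x V_x^{j+1}` is measurable, nonnegative and bounded by `|Λ(N)|^{j+2}`; its powers are integrable. [folklore] -/
theorem integrable_sum_pow_succ_pow (μ : Measure (BondConfig (Site d))) [IsFiniteMeasure μ] (N j t : ℕ) :
    Integrable (fun ω : BondConfig (Site d) => (∑ x ∈ box d N, ((((box d N).filter fun w =>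
      ω ∈ (openConn x w : Set (BondConfig (Site d)))).card : ℕ) : ℝ) ^ (j + 1)) ^ t) μ := by
  classical
  have hm : Measurable (fun ω : BondConfig (Site d) => (∑ x ∈ box d N, ((((box d N).filter fun w =>
      ω ∈ (openConn x w : Set (BondConfig (Site d)))).card : ℕ) : ℝ) ^ (j + 1)) ^ t) :=
    (Finset.measurable_sum _ fun x _ => (measurable_card_filter_openConn_root N x).pow_const _).pow_const _
  refine (integrable_const ((((box d N).card : ℝ) * ((box d N).card : ℝ) ^ (j + 1)) ^ t)).mono' hm.aestronglyMeasurable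
    (Filter.Eventually.of_forall fun ω => ?_)
  have h0 : (0 : ℝ) ≤ ∑ x ∈ box d N, ((((box d N).filter fun w =>
      ω ∈ (openConn x w : Set (BondConfig (Site d)))).card : ℕ) : ℝ) ^ (j + 1) :=
    Finset.sum_nonneg fun x _ => pow_nonneg (Nat.cast_nonneg _) _
  rw [Real.norm_eq_abs, abs_of_nonneg (pow_nonneg h0 t)]
  refine pow_le_pow_left₀ h0 ?_ t
  calc ∑ x ∈ box d N, ((((box d N).filter fun w => ω ∈ (openConn x w : Set (BondConfig (Site d)))).card : ℕ) : ℝ) ^ (j + 1)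
      ≤ ∑ x ∈ box d N, ((box d N).card : ℝ) ^ (j + 1) :=
        Finset.sum_le_sum fun x _ => pow_le_pow_left₀ (Nat.cast_nonneg _) (by exact_mod_cast Finset.card_filter_le _ _) _
    _ = ((box d N).card : ℝ) * ((box d N).card : ℝ) ^ (j + 1) := by rw [Finset.sum_const, nsmul_eq_mul]

open Classical in
/-- **ALL MOMENTS OF EVERY SIZE-BIASED CLUSTER SUM** (every `p > 0`, `d ≥ 1`, (R1), (R_lin), (R2), `π(1) > 0`): for all `j, t` there is
`C > 0` with, for all `N ≥ 1`,
`E_p (Σ_{x ∈ Λ(N)} V_x^{j+1})^{t+1} ≤ C · ((2N+1)^d π_p(N))^{(j+2)(t+1)}` (`Σ_x V_x^{j+1} = Σ_C |C ∩ Λ(N)|^{j+2}`):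
with `f = (Σ_x V_x^{j+1})^{t+1}` and `S = s(N)^{(j+2)(t+1)} > 0`, `f ≤ (S + f²/S)/2` pointwise, `f² ≤ T_N^{(j+2)(t+1)}` (§1), and part II
bounds `E T_N^{(j+2)(t+1)} ≤ C S²`. [cite: BorgsChayesKestenSpencer2001, Thm. 1.1] [cite: Kesten1986, Thm. (8)] -/
theorem exists_integral_sum_pow_pow_le (hd : 1 ≤ d) (p : unitInterval) (hp : 0 < (p : ℝ)) {A A' B : ℝ} (hA : 0 ≤ A)
    (hA' : 0 ≤ A')
    (hR1 : ∀ j n : ℕ, 1 ≤ j → j ≤ n →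
      oneArmProb d p j ^ 2 * ((j : ℝ) / (16 * n)) ^ (d - 1) ≤ A * oneArmProb d p n ^ 2)
    (hRlin : ∀ j n : ℕ, 1 ≤ j → j ≤ n →
      oneArmProb d p j * ((j : ℝ) / (4 * n)) ^ (d - 1) ≤ A' * oneArmProb d p n)
    (hR2 : ∀ j n : ℕ, 1 ≤ j → j ≤ n → n ≤ 8 * j → oneArmProb d p j ≤ B * oneArmProb d p n)
    (hπ1 : 0 < oneArmProb d p 1) (j t : ℕ) :
    ∃ C : ℝ, 0 < C ∧ ∀ N : ℕ, 1 ≤ N →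
      ∫ ω, (∑ x ∈ box d N, ((((box d N).filter fun w =>
          ω ∈ (openConn x w : Set (BondConfig (Site d)))).card : ℕ) : ℝ) ^ (j + 1)) ^ (t + 1) ∂(bondPercolation (zdGraph d) p) ≤
        C * ((2 * (N : ℝ) + 1) ^ d * oneArmProb d p N) ^ ((j + 2) * (t + 1)) := by
  classical
  -- part II at the exponent `(j+2)(t+1) = k + 1`
  obtain ⟨k, hk⟩ : ∃ k : ℕ, (j + 2) * (t + 1) = k + 1 := ⟨(j + 2) * (t + 1) - 1, by
    have : 1 ≤ (j + 2) * (t + 1) := Nat.one_le_iff_ne_zero.2 (by positivity); omega⟩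
  obtain ⟨C, hC, hle⟩ := exists_integral_pairCount_pow_le hd p hp hA hA' hR1 hRlin hR2 hπ1 k
  set μ := bondPercolation (zdGraph d) p with hμ
  refine ⟨(1 + C) / 2, by positivity, fun N hN => ?_⟩
  have hπpos : 0 < oneArmProb d p N := (pow_pos hp N).trans_le (DKT20.pow_le_real_siteToBoundary hd p N)
  set sN : ℝ := (2 * (N : ℝ) + 1) ^ d * oneArmProb d p N with hsN
  have hs : 0 < sN := mul_pos (by positivity) hπpos
  set S : ℝ := sN ^ ((j + 2) * (t + 1)) with hS
  have hSpos : 0 < S := pow_pos hs _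
  have hS0 : S ≠ 0 := hSpos.ne'
  have h2k : 2 * k + 2 = 2 * ((j + 2) * (t + 1)) := by omega
  -- pointwise AM–GM: `f ≤ (S + f²/S)/2`, and `f² ≤ T^{k+1}`
  have hpt : ∀ ω : BondConfig (Site d),
      (∑ x ∈ box d N, ((((box d N).filter fun w =>
          ω ∈ (openConn x w : Set (BondConfig (Site d)))).card : ℕ) : ℝ) ^ (j + 1)) ^ (t + 1) ≤
        (S + ((((box d N ×ˢ box d N).filter fun xw =>
          ω ∈ (openConn xw.1 xw.2 : Set (BondConfig (Site d)))).card : ℕ) : ℝ) ^ (k + 1) / S) / 2 := by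
    intro ω
    set f : ℝ := (∑ x ∈ box d N, ((((box d N).filter fun w =>
      ω ∈ (openConn x w : Set (BondConfig (Site d)))).card : ℕ) : ℝ) ^ (j + 1)) ^ (t + 1) with hf
    have hf2 : f ^ 2 ≤ ((((box d N ×ˢ box d N).filter fun xw =>
        ω ∈ (openConn xw.1 xw.2 : Set (BondConfig (Site d)))).card : ℕ) : ℝ) ^ (k + 1) := by
      rw [hf, ← hk, ← pow_mul, mul_comm (t + 1) 2, pow_mul, pow_mul]
      exact pow_le_pow_left₀ (sq_nonneg _) (sq_sum_pow_succ_le_pairCount_pow N j ω) _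
    have hamgm : f ≤ (S + f ^ 2 / S) / 2 := by
      rw [le_div_iff₀ (by norm_num : (0 : ℝ) < 2), ← sub_nonneg]
      have : S + f ^ 2 / S - f * 2 = (S - f) ^ 2 / S := by field_simp; ring
      rw [this]; exact div_nonneg (sq_nonneg _) hSpos.le
    have hdiv := div_le_div_of_nonneg_right hf2 hSpos.le
    exact hamgm.trans (by linarith)
  have hT := integrable_card_filter_pairSet_pow μ (box d N ×ˢ box d N) (k + 1)
  have hrhs : Integrable (fun ω : BondConfig (Site d) => (S + ((((box d N ×ˢ box d N).filter fun xw =>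
      ω ∈ (openConn xw.1 xw.2 : Set (BondConfig (Site d)))).card : ℕ) : ℝ) ^ (k + 1) / S) / 2) μ :=
    ((integrable_const S).add (hT.div_const S)).div_const 2
  calc ∫ ω, (∑ x ∈ box d N, ((((box d N).filter fun w =>
          ω ∈ (openConn x w : Set (BondConfig (Site d)))).card : ℕ) : ℝ) ^ (j + 1)) ^ (t + 1) ∂μ
      ≤ ∫ ω, (S + ((((box d N ×ˢ box d N).filter fun xw =>
          ω ∈ (openConn xw.1 xw.2 : Set (BondConfig (Site d)))).card : ℕ) : ℝ) ^ (k + 1) / S) / 2 ∂μ :=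
        integral_mono_of_nonneg (Filter.Eventually.of_forall fun ω =>
          pow_nonneg (Finset.sum_nonneg fun x _ => pow_nonneg (Nat.cast_nonneg _) _) _) hrhs (Filter.Eventually.of_forall hpt)
    _ = (S + (∫ ω, ((((box d N ×ˢ box d N).filter fun xw =>
          ω ∈ (openConn xw.1 xw.2 : Set (BondConfig (Site d)))).card : ℕ) : ℝ) ^ (k + 1) ∂μ) / S) / 2 := by
        rw [integral_div, integral_add (integrable_const S) (hT.div_const S), integral_div, integral_const]
        simp [hμ]
    _ ≤ (S + C * sN ^ (2 * k + 2) / S) / 2 := by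
        have hdiv := div_le_div_of_nonneg_right (hle N hN) hSpos.le
        linarith
    _ = (1 + C) / 2 * S := by
        rw [h2k, pow_mul', ← hS]
        field_simp

/-! ## §3 At `p_c(ℤ^d)` under (A2)□: two-sided -/

open Classical in
/-- **NO MULTISCALING OF THE CRITICAL CLUSTER-SIZE SUMS UNDER (A2)□** (`p_c(ℤ^d)`, `d ≥ 2`, (A2)□ at `(s,L)`, `2 ≤ s ≤ L`, `ϰ > 0`):
for all `j, t` there are `0 < c, C` and `N₀` with, for all `N ≥ N₀`,
`c · ((2N+1)^dπ_{p_c}(N))^{(j+2)(t+1)} ≤ E_{p_c} (Σ_C |C ∩ Λ_N|^{j+2})^{t+1} ≤ C · ((2N+1)^dπ_{p_c}(N))^{(j+2)(t+1)}`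
(`Σ_C |C ∩ Λ_N|^{j+2} = Σ_{x ∈ Λ(N)} V_x^{j+1}`).  Lower: `M_N^{j+2} ≤ Σ_x V_x^{j+1}` (gen 21) and the moments of the largest cluster;
upper: §2 with the (A2)□ ratio inequalities.  Every moment of every size-biased cluster sum of the critical box is of the order of
the corresponding power of `E|C_max(Λ_N)| ≍ |Λ_N|π_{p_c}(N)` (BCKS 2001 Thm. 1.1 under the Scaling Axioms; here from (A2)□, every `d`).
[cite: BorgsChayesKestenSpencer2001, Thm. 1.1] [cite: Kesten1986, Thm. (8)] [cite: BasuSapozhnikov2017ECP, §1 assumption (A2)] -/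
theorem exists_integral_sum_pow_pow_two_sided_of_setToSetQuasiMultAspectAt (hd : 2 ≤ d) {s L : ℕ} (hs : 2 ≤ s) (hsL : s ≤ L)
    {ϰ : ℝ} (hϰ : 0 < ϰ) (h : SetToSetQuasiMultAspectAt d (criticalProbI d) s L ϰ) (j t : ℕ) :
    ∃ c C : ℝ, 0 < c ∧ 0 < C ∧ ∃ N₀ : ℕ, ∀ N : ℕ, N₀ ≤ N →
      c * ((2 * (N : ℝ) + 1) ^ d * oneArmProb d (criticalProbI d) N) ^ ((j + 2) * (t + 1)) ≤
        ∫ ω, (∑ x ∈ box d N, ((((box d N).filter fun w =>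
          ω ∈ (openConn x w : Set (BondConfig (Site d)))).card : ℕ) : ℝ) ^ (j + 1)) ^ (t + 1)
            ∂(bondPercolation (zdGraph d) (criticalProbI d)) ∧
      ∫ ω, (∑ x ∈ box d N, ((((box d N).filter fun w =>
          ω ∈ (openConn x w : Set (BondConfig (Site d)))).card : ℕ) : ℝ) ^ (j + 1)) ^ (t + 1)
            ∂(bondPercolation (zdGraph d) (criticalProbI d)) ≤
        C * ((2 * (N : ℝ) + 1) ^ d * oneArmProb d (criticalProbI d) N) ^ ((j + 2) * (t + 1)) := by
  classical
  have hd1 : 1 ≤ d := by omega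
  obtain ⟨A, A', B, hA, hA', hR1, hRlin, hR2, hpc, hπ1⟩ := exists_ratios_of_setToSetQuasiMultAspectAt hd hs hsL hϰ h
  obtain ⟨C, hC, hup⟩ := exists_integral_sum_pow_pow_le hd1 (criticalProbI d) hpc hA hA' hR1 hRlin hR2 hπ1 j t
  obtain ⟨k, hk⟩ : ∃ k : ℕ, (j + 2) * (t + 1) = k + 1 := ⟨(j + 2) * (t + 1) - 1, by
    have : 1 ≤ (j + 2) * (t + 1) := Nat.one_le_iff_ne_zero.2 (by positivity); omega⟩
  obtain ⟨c, C', hc, -, N₀, hlow⟩ := exists_integral_sup_pow_two_sided_of_setToSetQuasiMultAspectAt hd hs hsL hϰ h k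
  set μ := bondPercolation (zdGraph d) (criticalProbI d) with hμ
  refine ⟨c, C, hc, hC, max N₀ 1, fun N hN => ⟨?_, hup N (le_of_max_le_right hN)⟩⟩
  have hl := (hlow N (le_of_max_le_left hN)).1
  rw [← hk] at hl
  refine hl.trans (integral_mono_of_nonneg (Filter.Eventually.of_forall fun ω => pow_nonneg (Nat.cast_nonneg _) _)
    (integrable_sum_pow_succ_pow μ N j (t + 1)) (Filter.Eventually.of_forall fun ω => ?_))
  -- `M^{(j+2)(t+1)} = (M^{j+2})^{t+1} ≤ (Σ_x V_x^{j+1})^{t+1}`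
  dsimp only
  rw [pow_mul]
  exact pow_le_pow_left₀ (pow_nonneg (Nat.cast_nonneg _) _) (pow_sup_le_sum_pow N (j + 1) ω) _

/-! ## §4 `ℤ²`, unconditionally -/

open Classical in
/-- **`ℤ²` at `p_c = 1/2`, UNCONDITIONALLY**: for all `j, t`, the `(t+1)`-st moment of `Σ_C |C ∩ Λ_N|^{j+2}` is
`≍ ((2N+1)² π_{1/2}(N))^{(j+2)(t+1)}`. [cite: BorgsChayesKestenSpencer2001, Thm. 1.1] [cite: Kesten1986, Thm. (8)] -/
theorem exists_integral_sum_pow_pow_two_sided_Z2 (j t : ℕ) :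
    ∃ c C : ℝ, 0 < c ∧ 0 < C ∧ ∃ N₀ : ℕ, ∀ N : ℕ, N₀ ≤ N →
      c * ((2 * (N : ℝ) + 1) ^ 2 * oneArmProb 2 (criticalProbI 2) N) ^ ((j + 2) * (t + 1)) ≤
        ∫ ω, (∑ x ∈ box 2 N, ((((box 2 N).filter fun w =>
          ω ∈ (openConn x w : Set (BondConfig (Site 2)))).card : ℕ) : ℝ) ^ (j + 1)) ^ (t + 1)
            ∂(bondPercolation (zdGraph 2) (criticalProbI 2)) ∧
      ∫ ω, (∑ x ∈ box 2 N, ((((box 2 N).filter fun w =>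
          ω ∈ (openConn x w : Set (BondConfig (Site 2)))).card : ℕ) : ℝ) ^ (j + 1)) ^ (t + 1)
            ∂(bondPercolation (zdGraph 2) (criticalProbI 2)) ≤
        C * ((2 * (N : ℝ) + 1) ^ 2 * oneArmProb 2 (criticalProbI 2) N) ^ ((j + 2) * (t + 1)) := by
  classical
  obtain ⟨ϰ, hϰ, hA2⟩ := exists_setToSetQuasiMultAspectAt_two_of_criticalProbI_le
  exact exists_integral_sum_pow_pow_two_sided_of_setToSetQuasiMultAspectAt (d := 2) le_rfl (by norm_num) (by norm_num) hϰ
    (hA2 _ le_rfl) j t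

end Rsw3

end Summit.CriticalPhenomena.PercolationContinuityZ3.Theorems
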